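import Mathlib

/-!
# Spectral projectors of a finite-order automorphism over a field with a primitive root

Shared eigenblock helper for the crux `PowersHodgeOfDeckCommutators` (stmt-HodgeConjecture-19545, route
`CyclicUnitaryPowers`, line `unitary-kunneth-fft` v5, lane 2 stubs D₂ `stub_deckUnitaryCommutatorGeneration`,
T `stub_unitaryTorusLemma`, L `stub_deckUnitaryInvariantsMatching`), requested by the planner (P3 g21): the
spectral projectors
`P_j = p⁻¹ Σ_{i<p} (ζ^{ij})⁻¹ σⁱ`
of an endomorphism `σ` with `σ ^ p = 1` over a field `K` containing a primitive `p`-th root of unity `ζ`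
(`(p : K) ≠ 0`), written EXACTLY in the shape used by the registered stubs
(`((p : K)⁻¹) • ∑ i ∈ Finset.range p, ((ζ ^ (i * j))⁻¹) • σ ^ i`), and their algebra: the discrete Fourier
identity, `σ ∘ P_j = ζ^j • P_j`, `P_j = id` on the `ζ^j`-eigenspace and `= 0` on the others, `Σ_j P_j = 1`,
`P_j P_k = [j ≡ k] P_j`, the range of `P_j` is the eigenspace, and the adjunction `B(P_j x, y) = B(x, P_{p-j} y)`
for a `σ`-invariant bilinear form `B` (so distinct eigenspaces pair trivially unless the exponents add up to
`0 mod p`).  Pure linear algebra (discrete Fourier transform on `ℤ/p`); no Hodge theory.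
-/

noncomputable section

open Module
open scoped BigOperators

namespace Summit.HodgeConjecture.HodgeConjecture.Theorems.CyclicUnitaryPowersSpectralProjectors

variable {K : Type*} [Field K] {W : Type*} [AddCommGroup W] [Module K W]

/-- The spectral projector `P_j = p⁻¹ Σ_{i<p} (ζ^{ij})⁻¹ σⁱ` (the shape of the registered stubs D₂/T of
crux K2-A). [folklore] -/
def specProj (σ : W →ₗ[K] W) (ζ : K) (p j : ℕ) : W →ₗ[K] W :=
  ((p : K)⁻¹) • ∑ i ∈ Finset.range p, ((ζ ^ (i * j))⁻¹) • σ ^ i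

/-- Unfolding lemma. [folklore] -/
theorem specProj_def (σ : W →ₗ[K] W) (ζ : K) (p j : ℕ) :
    specProj σ ζ p j = ((p : K)⁻¹) • ∑ i ∈ Finset.range p, ((ζ ^ (i * j))⁻¹) • σ ^ i := rfl

/-! ### The discrete Fourier identity -/

/-- `Σ_{i<p} ζ^{i m} = p` if `p ∣ m`, and `= 0` otherwise, for a primitive `p`-th root `ζ`. [folklore] -/
theorem sum_pow_mul_eq {ζ : K} {p : ℕ} (hζ : IsPrimitiveRoot ζ p) (m : ℕ) :
    ∑ i ∈ Finset.range p, ζ ^ (i * m) = if p ∣ m then (p : K) else 0 := by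
  have hpow : ∀ i, ζ ^ (i * m) = (ζ ^ m) ^ i := fun i => by rw [← pow_mul, mul_comm]
  simp_rw [hpow]
  split_ifs with h
  · rw [(hζ.pow_eq_one_iff_dvd m).mpr h]
    simp
  · have hne : ζ ^ m ≠ 1 := fun h1 => h ((hζ.pow_eq_one_iff_dvd m).mp h1)
    rw [geom_sum_eq hne, ← pow_mul, mul_comm, pow_mul, hζ.pow_eq_one, one_pow, sub_self, zero_div]

/-- The inverse powers: `(ζ^{ij})⁻¹ = ζ^{i (p-1) j}` — a form in which all exponents are natural numbers.
[folklore] -/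
theorem inv_pow_mul_eq {ζ : K} {p : ℕ} (hζ : IsPrimitiveRoot ζ p) (hp : 0 < p) (i j : ℕ) :
    (ζ ^ (i * j))⁻¹ = ζ ^ (i * ((p - 1) * j)) := by
  have h : ζ ^ (p - 1) = ζ⁻¹ := by
    refine eq_inv_of_mul_eq_one_left ?_
    rw [← pow_succ, Nat.sub_add_cancel hp, hζ.pow_eq_one]
  have e : i * ((p - 1) * j) = (p - 1) * (i * j) := by ring
  rw [e]
  conv_rhs => rw [pow_mul, h, inv_pow]

/-! ### `σ P_j = ζ^j P_j` and the values of `P_j` on eigenvectors -/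

section Basic

variable {σ : W →ₗ[K] W} {ζ : K} {p : ℕ}

/-- Cyclic reindexing: `Σ_{i<p} f (i+1) = Σ_{i<p} f i` when `f p = f 0`. [folklore] -/
theorem sum_range_succ_shift {M : Type*} [AddCommGroup M] (f : ℕ → M) (hp : f p = f 0) :
    ∑ i ∈ Finset.range p, f (i + 1) = ∑ i ∈ Finset.range p, f i := by
  have h1 := Finset.sum_range_succ' f p
  have h2 := Finset.sum_range_succ f p
  rw [hp] at h2
  rw [h2] at h1
  exact (add_right_cancel h1).symm

/-- **`σ (P_j x) = ζ^j • P_j x`.** [folklore] -/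
theorem apply_specProj (hσ : σ ^ p = 1) (hζ : IsPrimitiveRoot ζ p) (hp : 0 < p) (j : ℕ) (x : W) :
    σ (specProj σ ζ p j x) = (ζ ^ j) • specProj σ ζ p j x := by
  have hζ0 : ζ ≠ 0 := hζ.ne_zero hp.ne'
  have hc : ∀ i : ℕ, ζ ^ j * (ζ ^ ((i + 1) * j))⁻¹ = (ζ ^ (i * j))⁻¹ := by
    intro i
    rw [add_mul, one_mul, pow_add, mul_inv, mul_comm (ζ ^ j), mul_assoc, inv_mul_cancel₀ (pow_ne_zero _ hζ0),
      mul_one]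
  calc σ (specProj σ ζ p j x)
      = (p : K)⁻¹ • ∑ i ∈ Finset.range p, ((ζ ^ (i * j))⁻¹) • (σ ^ (i + 1)) x := by
        rw [specProj_def, LinearMap.smul_apply, LinearMap.sum_apply, map_smul, map_sum]
        congr 1
        refine Finset.sum_congr rfl fun i _ => ?_
        rw [LinearMap.smul_apply, map_smul, pow_succ', Module.End.mul_apply]
    _ = (p : K)⁻¹ • ∑ i ∈ Finset.range p, (ζ ^ j * (ζ ^ ((i + 1) * j))⁻¹) • (σ ^ (i + 1)) x := by
        congr 1
        exact Finset.sum_congr rfl fun i _ => by rw [hc i]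
    _ = (p : K)⁻¹ • ∑ i ∈ Finset.range p, (ζ ^ j * (ζ ^ (i * j))⁻¹) • (σ ^ i) x := by
        congr 1
        exact sum_range_succ_shift (fun i => (ζ ^ j * (ζ ^ (i * j))⁻¹) • (σ ^ i) x)
          (by rw [hσ, zero_mul, pow_zero, pow_zero, pow_mul, hζ.pow_eq_one, one_pow])
    _ = (p : K)⁻¹ • ((ζ ^ j) • ∑ i ∈ Finset.range p, ((ζ ^ (i * j))⁻¹) • (σ ^ i) x) := by
        congr 1
        rw [Finset.smul_sum]
        exact Finset.sum_congr rfl fun i _ => by rw [smul_smul]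
    _ = (ζ ^ j) • specProj σ ζ p j x := by
        rw [smul_comm ((p : K)⁻¹) (ζ ^ j), specProj_def, LinearMap.smul_apply, LinearMap.sum_apply]
        simp only [LinearMap.smul_apply]

/-- **`σ ∘ P_j = ζ^j • P_j`.** [folklore] -/
theorem comp_specProj (hσ : σ ^ p = 1) (hζ : IsPrimitiveRoot ζ p) (hp : 0 < p) (j : ℕ) :
    σ ∘ₗ specProj σ ζ p j = (ζ ^ j) • specProj σ ζ p j :=
  LinearMap.ext fun x => by rw [LinearMap.comp_apply, apply_specProj hσ hζ hp j x, LinearMap.smul_apply]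

/-- The range of `P_j` lies in the `ζ^j`-eigenspace. [folklore] -/
theorem specProj_mem_eigenspace (hσ : σ ^ p = 1) (hζ : IsPrimitiveRoot ζ p) (hp : 0 < p) (j : ℕ) (x : W) :
    specProj σ ζ p j x ∈ Module.End.eigenspace σ (ζ ^ j) := by
  rw [Module.End.mem_eigenspace_iff]
  exact apply_specProj hσ hζ hp j x

/-- **`P_j` on a `ζ^k`-eigenvector**: the identity if `j ≡ k (mod p)`, zero otherwise. [folklore] -/
theorem specProj_apply_of_eigenvector [CharZero K] (hζ : IsPrimitiveRoot ζ p) (hp : 0 < p) (j k : ℕ) {x : W}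
    (hx : σ x = (ζ ^ k) • x) :
    specProj σ ζ p j x = if p ∣ (k + (p - 1) * j) then x else 0 := by
  have hp0 : (p : K) ≠ 0 := Nat.cast_ne_zero.mpr hp.ne'
  have hpow : ∀ i : ℕ, (σ ^ i) x = (ζ ^ k) ^ i • x := by
    intro i
    induction i with
    | zero => simp
    | succ n ih => rw [pow_succ', Module.End.mul_apply, ih, map_smul, hx, smul_smul, ← pow_succ]
  rw [specProj_def, LinearMap.smul_apply, LinearMap.sum_apply]
  simp_rw [LinearMap.smul_apply, hpow, smul_smul, inv_pow_mul_eq hζ hp]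
  have hterm : ∀ i : ℕ, ζ ^ (i * ((p - 1) * j)) * (ζ ^ k) ^ i = ζ ^ (i * (k + (p - 1) * j)) := fun i => by
    rw [← pow_mul, ← pow_add]; ring_nf
  simp_rw [hterm]
  rw [← Finset.sum_smul, sum_pow_mul_eq hζ]
  split_ifs with h
  · rw [smul_smul, inv_mul_cancel₀ hp0, one_smul]
  · rw [zero_smul, smul_zero]

/-- `P_j` is the identity on the `ζ^j`-eigenspace. [folklore] -/
theorem specProj_apply_of_mem_eigenspace [CharZero K] (hζ : IsPrimitiveRoot ζ p) (hp : 0 < p) (j : ℕ) {x : W}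
    (hx : x ∈ Module.End.eigenspace σ (ζ ^ j)) : specProj σ ζ p j x = x := by
  rw [Module.End.mem_eigenspace_iff] at hx
  rw [specProj_apply_of_eigenvector hζ hp j j hx, if_pos]
  have : j + (p - 1) * j = p * j := by
    zify [hp]
    ring
  rw [this]
  exact dvd_mul_right p j

/-- `P_j` vanishes on the `ζ^k`-eigenspace for `k ≢ j (mod p)` (`j, k < p`, `j ≠ k`). [folklore] -/
theorem specProj_apply_of_mem_eigenspace_of_ne [CharZero K] (hζ : IsPrimitiveRoot ζ p) (hp : 0 < p) {j k : ℕ}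
    (hj : j < p) (hk : k < p) (hjk : j ≠ k) {x : W} (hx : x ∈ Module.End.eigenspace σ (ζ ^ k)) :
    specProj σ ζ p j x = 0 := by
  rw [Module.End.mem_eigenspace_iff] at hx
  rw [specProj_apply_of_eigenvector hζ hp j k hx, if_neg]
  intro hdvd
  -- `p ∣ k + (p-1) j` with `j, k < p` forces `j = k`: `k + (p-1) j = k - j + p j`
  have h1 : (p : ℤ) ∣ (k : ℤ) - j := by
    have h2 : ((k + (p - 1) * j : ℕ) : ℤ) = (k : ℤ) - j + p * j := by
      push_cast [Nat.cast_sub hp, Nat.cast_one]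
      ring
    have h3 : (p : ℤ) ∣ ((k + (p - 1) * j : ℕ) : ℤ) := Int.natCast_dvd_natCast.mpr hdvd
    rw [h2] at h3
    exact (dvd_add_left (dvd_mul_right _ _)).mp h3
  rcases h1 with ⟨c, hc⟩
  have hlt : |(k : ℤ) - j| < p := by
    rw [abs_sub_lt_iff]; constructor <;> omega
  rw [hc, abs_mul, Nat.abs_cast] at hlt
  have hc0 : c = 0 := by
    by_contra hne
    have : (1 : ℤ) ≤ |c| := Int.one_le_abs hne
    nlinarith [this, hlt, (show (0 : ℤ) < p by exact_mod_cast hp)]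
  rw [hc0, mul_zero, sub_eq_zero] at hc
  exact hjk (by exact_mod_cast hc.symm)

/-- **`Σ_{j<p} P_j = 1`.** [folklore] -/
theorem sum_specProj [CharZero K] (hζ : IsPrimitiveRoot ζ p) (hp : 0 < p) :
    ∑ j ∈ Finset.range p, specProj σ ζ p j = 1 := by
  have hp0 : (p : K) ≠ 0 := Nat.cast_ne_zero.mpr hp.ne'
  simp_rw [specProj_def]
  rw [← Finset.smul_sum, Finset.sum_comm]
  have hinner : ∀ i ∈ Finset.range p, ∑ j ∈ Finset.range p, ((ζ ^ (i * j))⁻¹) • σ ^ i =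
      if i = 0 then (p : K) • σ ^ i else 0 := by
    intro i hi
    rw [← Finset.sum_smul]
    simp_rw [inv_pow_mul_eq hζ hp]
    have e : ∀ j, ζ ^ (i * ((p - 1) * j)) = ζ ^ (j * (i * (p - 1))) := fun j => by ring_nf
    simp_rw [e]
    rw [sum_pow_mul_eq hζ]
    have hi' : i < p := Finset.mem_range.mp hi
    by_cases h0 : i = 0
    · subst h0; simp
    · rw [if_neg, if_neg h0, zero_smul]
      intro hdvd
      -- `p ∣ i (p-1) = i p - i` with `0 < i < p` is impossible
      have h1 : (p : ℤ) ∣ (i : ℤ) * (p - 1) := by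
        have h := Int.natCast_dvd_natCast.mpr hdvd
        push_cast [Nat.cast_sub hp] at h
        exact h
      have h2 : (p : ℤ) ∣ (i : ℤ) := by
        have h3 : (p : ℤ) ∣ (i : ℤ) * p := dvd_mul_left _ _
        have h4 := dvd_sub h3 h1
        have e : (i : ℤ) * p - i * (p - 1) = i := by ring
        rwa [e] at h4
      have h5 : p ∣ i := Int.natCast_dvd_natCast.mp h2
      exact absurd (Nat.le_of_dvd (Nat.pos_of_ne_zero h0) h5) (not_le.mpr hi')
  rw [Finset.sum_congr rfl hinner, Finset.sum_ite_eq' (Finset.range p) 0 (fun i => (p : K) • σ ^ i),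
    if_pos (Finset.mem_range.mpr hp), pow_zero, smul_smul, inv_mul_cancel₀ hp0, one_smul]

/-- **`P_j P_k = P_j` if `j = k` and `= 0` otherwise** (`j, k < p`). [folklore] -/
theorem specProj_comp_specProj [CharZero K] (hσ : σ ^ p = 1) (hζ : IsPrimitiveRoot ζ p) (hp : 0 < p) {j k : ℕ}
    (hj : j < p) (hk : k < p) :
    specProj σ ζ p j ∘ₗ specProj σ ζ p k = if j = k then specProj σ ζ p j else 0 := by
  ext x
  rw [LinearMap.comp_apply]
  split_ifs with h
  · subst h
    exact specProj_apply_of_mem_eigenspace hζ hp j (specProj_mem_eigenspace hσ hζ hp j x)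
  · rw [LinearMap.zero_apply]
    exact specProj_apply_of_mem_eigenspace_of_ne hζ hp hj hk h (specProj_mem_eigenspace hσ hζ hp k x)

/-- The range of `P_j` is the `ζ^j`-eigenspace of `σ`. [folklore] -/
theorem range_specProj [CharZero K] (hσ : σ ^ p = 1) (hζ : IsPrimitiveRoot ζ p) (hp : 0 < p) (j : ℕ) :
    LinearMap.range (specProj σ ζ p j) = Module.End.eigenspace σ (ζ ^ j) := by
  apply le_antisymm
  · rintro _ ⟨x, rfl⟩
    exact specProj_mem_eigenspace hσ hζ hp j x
  · intro x hx
    exact ⟨x, specProj_apply_of_mem_eigenspace hζ hp j hx⟩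

/-- A vector is the sum of its spectral components. [folklore] -/
theorem sum_specProj_apply [CharZero K] (hζ : IsPrimitiveRoot ζ p) (hp : 0 < p) (x : W) :
    ∑ j ∈ Finset.range p, specProj σ ζ p j x = x := by
  have h := LinearMap.congr_fun (sum_specProj (σ := σ) hζ hp) x
  rwa [LinearMap.sum_apply, Module.End.one_apply] at h

end Basic

/-! ### Adjunction with respect to a `σ`-invariant bilinear form -/

section Adjoint

variable {σ : W →ₗ[K] W} {ζ : K} {p : ℕ} {B : LinearMap.BilinForm K W}

/-- For a `σ`-invariant form and `σ ^ p = 1`: `B (σⁱ x) y = B x (σ^{p-i} y)` (`i ≤ p`). [folklore] -/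
theorem apply_pow_left (hσ : σ ^ p = 1) (hB : ∀ x y, B (σ x) (σ y) = B x y) {i : ℕ} (hi : i ≤ p) (x y : W) :
    B ((σ ^ i) x) y = B x ((σ ^ (p - i)) y) := by
  have hk : ∀ (k : ℕ) (x y : W), B ((σ ^ k) x) ((σ ^ k) y) = B x y := by
    intro k
    induction k with
    | zero => intro x y; simp
    | succ n ih => intro x y; rw [pow_succ', Module.End.mul_apply, Module.End.mul_apply, hB, ih]
  have e : y = (σ ^ i) ((σ ^ (p - i)) y) := by
    rw [← Module.End.mul_apply, ← pow_add, Nat.add_sub_cancel' hi, hσ, Module.End.one_apply]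
  conv_lhs => rw [e]
  rw [hk]

/-- **Orthogonality of eigencomponents**: `B (P_k x) (P_l y) = 0` unless `p ∣ k + l`, for a `σ`-invariant
form `B`. [folklore] -/
theorem apply_specProj_specProj_eq_zero [CharZero K] (hσ : σ ^ p = 1) (hζ : IsPrimitiveRoot ζ p) (hp : 0 < p)
    (hB : ∀ x y, B (σ x) (σ y) = B x y) {k l : ℕ} (hkl : ¬ p ∣ k + l) (x y : W) :
    B (specProj σ ζ p k x) (specProj σ ζ p l y) = 0 := by
  have h := hB (specProj σ ζ p k x) (specProj σ ζ p l y)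
  rw [apply_specProj hσ hζ hp k x, apply_specProj hσ hζ hp l y] at h
  simp only [map_smul, LinearMap.smul_apply, smul_eq_mul] at h
  have hne : ζ ^ (k + l) ≠ 1 := fun h1 => hkl ((hζ.pow_eq_one_iff_dvd (k + l)).mp h1)
  have h2 : (ζ ^ (k + l) - 1) * B (specProj σ ζ p k x) (specProj σ ζ p l y) = 0 := by
    rw [pow_add]
    linear_combination h
  exact (mul_eq_zero.mp h2).resolve_left (sub_ne_zero.mpr hne)

end Adjoint

/-! ### Block determinants: `det (γ P + (1 - P)) = det (γ|_{range P})` -/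

section BlockDet

/-- A map commuting with an idempotent `P` preserves `range P`. [folklore] -/
theorem mapsTo_range_of_commute {P γ : Module.End K W} (hc : γ * P = P * γ) :
    ∀ x ∈ LinearMap.range P, γ x ∈ LinearMap.range P := by
  rintro _ ⟨y, rfl⟩
  exact ⟨γ y, by rw [← Module.End.mul_apply, ← hc, Module.End.mul_apply]⟩

variable [FiniteDimensional K W]

/-- **Block determinant**: for an idempotent `P` and `γ` commuting with `P`,
`det (γ P + (1 - P)) = det (γ|_{range P})`. [folklore] -/
theorem det_mul_proj_add_one_sub {P γ : Module.End K W} (hP : IsIdempotentElem P) (hc : γ * P = P * γ) :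
    LinearMap.det (γ * P + (1 - P)) = LinearMap.det (γ.restrict (mapsTo_range_of_commute hc)) := by
  set E₁ := LinearMap.range P with hE₁
  set E₂ := LinearMap.ker P with hE₂
  have h : IsCompl E₁ E₂ := LinearMap.IsIdempotentElem.isCompl hP
  set e := Submodule.prodEquivOfIsCompl E₁ E₂ h with he
  set γE : E₁ →ₗ[K] E₁ := γ.restrict (mapsTo_range_of_commute hc) with hγE
  have key : γ * P + (1 - P) =
      (e : (E₁ × E₂) →ₗ[K] W) ∘ₗ (LinearMap.prodMap γE LinearMap.id) ∘ₗ (e.symm : W →ₗ[K] (E₁ × E₂)) := by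
    apply LinearMap.ext
    intro x
    obtain ⟨y, rfl⟩ : ∃ y, e y = x := ⟨e.symm x, e.apply_symm_apply x⟩
    rw [LinearMap.comp_apply, LinearMap.comp_apply, LinearEquiv.coe_coe, LinearEquiv.coe_coe,
      e.symm_apply_apply]
    obtain ⟨x₁, x₂⟩ := y
    have h1 : P x₁ = x₁ := (LinearMap.IsIdempotentElem.mem_range_iff hP).mp x₁.2
    have h2 : P x₂ = 0 := x₂.2
    rw [he, Submodule.coe_prodEquivOfIsCompl', Submodule.coe_prodEquivOfIsCompl', LinearMap.prodMap_apply,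
      LinearMap.id_apply, LinearMap.add_apply, LinearMap.sub_apply, Module.End.mul_apply, Module.End.one_apply,
      map_add, h1, h2, add_zero, hγE, LinearMap.coe_restrict_apply]
    abel
  rw [key, LinearMap.det_conj (LinearMap.prodMap γE LinearMap.id) e, LinearMap.det_prodMap, LinearMap.det_id,
    mul_one]

end BlockDet

/-! ### The spectral projectors are idempotent and commute with the centraliser of `σ` -/

section Idempotent

variable {σ : W →ₗ[K] W} {ζ : K} {p : ℕ}

/-- `P_j` is idempotent. [folklore] -/
theorem isIdempotentElem_specProj [CharZero K] (hσ : σ ^ p = 1) (hζ : IsPrimitiveRoot ζ p) (hp : 0 < p) (j : ℕ) :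
    IsIdempotentElem (specProj σ ζ p j) := by
  rw [IsIdempotentElem, Module.End.mul_eq_comp]
  ext x
  rw [LinearMap.comp_apply]
  exact specProj_apply_of_mem_eigenspace hζ hp j (specProj_mem_eigenspace hσ hζ hp j x)

omit [Field K] in
/-- An endomorphism commuting with `σ` commutes with every `P_j`. [folklore] -/
theorem commute_specProj {K : Type*} [Field K] {W : Type*} [AddCommGroup W] [Module K W] {σ : W →ₗ[K] W}
    {ζ : K} {p : ℕ} (γ : Module.End K W) (hγ : γ * σ = σ * γ) (j : ℕ) :
    γ * specProj σ ζ p j = specProj σ ζ p j * γ := by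
  have hpow : ∀ i : ℕ, γ * σ ^ i = σ ^ i * γ := fun i => ((Commute.pow_right (show Commute γ σ from hγ) i)).eq
  rw [specProj_def, mul_smul_comm, smul_mul_assoc, Finset.mul_sum, Finset.sum_mul]
  congr 1
  refine Finset.sum_congr rfl fun i _ => ?_
  rw [mul_smul_comm, smul_mul_assoc, hpow]

/-- **Block determinant at an eigenspace**: for `γ` commuting with `σ`,
`det (γ ∘ P_j + (1 - P_j)) = det (γ|_{range P_j})` (and `range P_j` is the `ζ^j`-eigenspace, `range_specProj`).
[folklore] -/
theorem det_comp_specProj_add [CharZero K] [FiniteDimensional K W] (hσ : σ ^ p = 1) (hζ : IsPrimitiveRoot ζ p)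
    (hp : 0 < p) (γ : Module.End K W) (hγ : γ * σ = σ * γ) (j : ℕ) :
    LinearMap.det (γ ∘ₗ specProj σ ζ p j + (1 - specProj σ ζ p j)) =
      LinearMap.det (γ.restrict (mapsTo_range_of_commute (commute_specProj (ζ := ζ) (p := p) γ hγ j))) := by
  rw [← Module.End.mul_eq_comp]
  exact det_mul_proj_add_one_sub (isIdempotentElem_specProj hσ hζ hp j) (commute_specProj γ hγ j)

end Idempotent



end Summit.HodgeConjecture.HodgeConjecture.Theorems.CyclicUnitaryPowersSpectralProjectors

end
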